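import Literature.MathematicalPhysics.QuantumLattice.GibbsEntropy
import Literature.InformationTheory.Entropy.VonNeumannEntropyInequalities
import Literature.InformationTheory.Entropy.GibbsInequality
import HarnessLib

/-!
# The Gibbs variational principle for finite quantum systems and free-energy ⇒ energy windows

Topic `Literature/MathematicalPhysics/QuantumLattice` (thermal toolkit: `FinDimSpectrum.lean` has
`Matrix.gibbsWeight/partitionFn/gibbsState`, `DuhamelTwoPoint.lean` the Peierls–Bogoliubov inequality
in TRIAL-HAMILTONIAN form `Z(H+W) ≥ Z(H) e^{-β⟨W⟩_H}` and the energy–entropy bound, `GibbsEntropy.lean`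
the entropy `Matrix.gibbsEntropy β H = log Z_β + β Re⟨H⟩_β` of the Gibbs state, and
`GibbsPressureTemperature.lean` the convexity of `β ↦ log Z_β`). This file adds, for a Hermitian matrix
`H` on a finite index type, everything PROVED (no named facts, no definitions):

* **The Gibbs variational principle in DENSITY-MATRIX form** (`IsHermitian.vonNeumannEntropy_sub_mul_le_log_partitionFn`):
  for every density matrix `ρ` (`ρ ≥ 0`, `tr ρ = 1`) and every real `β`,
  `S(ρ) − β Re tr(ρH) ≤ log Z_β(H)`, `S` the von Neumann entropy of
  `Literature/InformationTheory/Entropy/VonNeumannEntropy.lean`; free-energy form for `β > 0`: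
  `−β⁻¹ log Z_β(H) ≤ Re tr(ρH) − β⁻¹ S(ρ)` (`IsHermitian.helmholtz_le_energy_sub_entropy_div`).
  Proof = the printed one: diagonalise `ρ = V diag(p) V⋆`, apply Gibbs' inequality to the probability
  vector `p` against the Boltzmann weights of the diagonal `(V⋆HV)ᵢᵢ` (`sum_negMulLog_add_mul_le_log_sum_exp`),
  then Peierls' inequality `Σᵢ e^{(M)ᵢᵢ} ≤ tr e^{M}` (`IsHermitian.sum_exp_apply_le_trace_exp`) and
  `Z(V⋆HV) = Z(H)`.
* **The Gibbs state attains it**: the density matrix `ρ_β = Z_β⁻¹ e^{-βH}` is a density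
  (`IsHermitian.posSemidef_gibbsDensity`, `trace_gibbsDensity`), its energy is `Re⟨H⟩_β`
  (`trace_gibbsDensity_mul`) and its von Neumann entropy IS `Matrix.gibbsEntropy β H`
  (`IsHermitian.vonNeumannEntropy_gibbsDensity`), so that `log Z_β = max_ρ [S(ρ) − β Re tr(ρH)]`
  (`IsHermitian.log_partitionFn_eq_gibbs_sup`).
* **Free energy, energy, ground energy** (`β > 0`): `−log Z_β ≤ β E₀ ≤ β Re⟨H⟩_β`
  (`IsHermitian.neg_log_partitionFn_le_mul_groundEnergy`, `IsHermitian.groundEnergy_le_re_gibbsState_self`),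
  `−log Z_β ≤ β Re⟨H⟩_β ≤ log dim − log Z_β` (`F ≤ E ≤ F + T·S_max`:
  `IsHermitian.neg_log_partitionFn_le_mul_energy`, `IsHermitian.mul_energy_le_log_card_sub_log_partitionFn`).
* **Free-energy windows ⇒ energy windows** (the composition a positive-temperature certificate family
  needs; `E_β := Re⟨H⟩_β`, `β_h < β < β_c`, all positive): the two convexity chords
  `(log Z_β − log Z_{β_c})/(β_c − β) ≤ E_β ≤ (log Z_{β_h} − log Z_β)/(β − β_h)`
  (`IsHermitian.chord_le_energy`, `IsHermitian.energy_le_chord`), the packaged numeric forms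
  `IsHermitian.energy_window_of_log_partitionFn_bounds` (from one LOWER bound on `log Z_β` — a
  Gibbs–Bogoliubov / trial-state upper bound on the free energy — and UPPER bounds on `log Z` at a
  hotter and a colder temperature) and `IsHermitian.energy_window_of_groundEnergy_bound` (from a lower
  bound on `E₀` and a lower bound on `log Z_β`: `ℓ₀ ≤ E_β ≤ (log dim − ℓ)/β`), and the transfer of an
  energy bound along the temperature axis by monotonicity (`IsHermitian.energy_le_of_le_of_le`,
  `IsHermitian.le_energy_of_le_of_le`).

Consumers: the `T > 0` certificate family of the Hubbard cell (sr-mbsolver/hubbard-thermal: certified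
thermal energy windows from free-energy two-sided bounds), Hubbard routes `ThermalWedge` / `GibbsMajorant`.

Sources (all statements are textbook; finite-dimensional matrix forms folklore): the variational
principle and `F(T) = −T log Z(T)` [cite: GustafsonSigal2003, §18.3 (18.12)–(18.13), Problem 18.9]
[cite: Petz2008, §3.7 Exercise 13]; convexity of `log Z` in `β` and the thermodynamic inequalities
[cite: Ruelle1969, §2.5–2.6]; von Neumann entropy [cite: NielsenChuang2010, §11.3 (11.40)].
Tree search (2026-08-26): `lean search` for `vonNeumannEntropy.*partitionFn`, `quantumRelEntropy_nonneg`,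
`klein` — no density-matrix form of the principle and no Klein inequality in the tree; the
trial-Hamiltonian form is `Matrix.peierls_bogoliubov` (not restated). Presearch: corpus
[GustafsonSigal2003 p.212–213] (hybrid search "Gibbs variational principle free energy minimized");
galaxy substring `Gibbs variational principle|Peierls-Bogoliubov` — no usable hit.
-/

noncomputable section

open scoped Matrix.Norms.L2Operator ComplexOrder
open Finset Literature.InformationTheory.Entropy Literature.MathematicalPhysics.QuantumLattice

namespace Matrix

variable {n : Type*} [Fintype n] [DecidableEq n]

/-! ### The classical core: Gibbs' inequality against Boltzmann weights -/

omit [DecidableEq n] in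
/-- **Gibbs' inequality, log-sum-exp form**: for a probability vector `p` and reals `bᵢ`,
`Σᵢ η(pᵢ) + Σᵢ pᵢ bᵢ ≤ log Σᵢ e^{bᵢ}` (`η(x) = −x log x`), with equality iff `pᵢ ∝ e^{bᵢ}`. This is
`0 ≤ Σ pᵢ log(pᵢ/φᵢ)` (`sum_mul_log_div_nonneg`) for `φᵢ = e^{bᵢ}/Σⱼ e^{bⱼ}`; in convex-analysis terms, the
conjugate of log-sum-exp is the negative entropy restricted to the probability simplex.
[cite: BoydVandenberghe2004, §3.3.1 Example 3.25] -/
theorem sum_negMulLog_add_mul_le_log_sum_exp [Nonempty n] {p : n → ℝ} (hp : ∀ i, 0 ≤ p i)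
    (hp1 : ∑ i, p i = 1) (b : n → ℝ) :
    ∑ i, Real.negMulLog (p i) + ∑ i, p i * b i ≤ Real.log (∑ i, Real.exp (b i)) := by
  set W : ℝ := ∑ i, Real.exp (b i) with hW
  have hWpos : 0 < W := sum_pos (fun i _ => Real.exp_pos _) univ_nonempty
  set φ : n → ℝ := fun i => Real.exp (b i) / W with hφ
  have hφpos : ∀ i, 0 < φ i := fun i => div_pos (Real.exp_pos _) hWpos
  have hsum : ∑ i, p i = ∑ i, φ i := by
    rw [hp1, hφ]
    simp only
    rw [← sum_div, ← hW, div_self hWpos.ne']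
  have hG := sum_mul_log_div_nonneg hp hφpos hsum
  have hterm : ∀ i, p i * Real.log (p i / φ i) =
      -Real.negMulLog (p i) - p i * b i + p i * Real.log W := by
    intro i
    rcases (hp i).eq_or_lt with h0 | hpos
    · rw [← h0]; simp
    · rw [Real.log_div hpos.ne' (hφpos i).ne', Real.negMulLog, hφ]
      simp only
      rw [Real.log_div (Real.exp_pos _).ne' hWpos.ne', Real.log_exp]
      ring
  simp only [hterm, sum_add_distrib, sum_sub_distrib, sum_neg_distrib, ← sum_mul, hp1,
    one_mul] at hG
  linarith

/-! ### The Gibbs variational principle (density-matrix form) -/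

section VariationalPrinciple

variable {H : Matrix n n ℂ}

omit [DecidableEq n] in
/-- A trace-one matrix lives on a nonempty index type. [folklore] -/
private theorem nonempty_of_trace_eq_one {ρ : Matrix n n ℂ} (htr : ρ.trace = 1) : Nonempty n := by
  by_contra hne
  rw [not_nonempty_iff] at hne
  have h0 : ρ.trace = 0 := by simp [Matrix.trace]
  rw [h0] at htr
  exact zero_ne_one htr

/-- **The Gibbs variational principle** (finite quantum system, density-matrix form): for a Hermitian
`H`, every real `β` and every density matrix `ρ` (`ρ ≥ 0`, `tr ρ = 1`),
`S(ρ) − β Re tr(ρ H) ≤ log Z_β(H)` with `Z_β(H) = tr e^{-βH}` and `S` the von Neumann entropy.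
Equivalently the Gibbs state maximises `S − β E` / minimises the Helmholtz free energy `E − T S`,
whose minimum is `−T log Z` (`IsHermitian.vonNeumannEntropy_gibbsDensity` for the equality).
Proof: in an eigenbasis `ρ = V diag(p) V⋆`, `Re tr(ρH) = Σ pᵢ Kᵢᵢ` with `K = V⋆HV`; Gibbs' inequality
gives `Σ η(pᵢ) − β Σ pᵢ Kᵢᵢ ≤ log Σ e^{-βKᵢᵢ}`, and Peierls' inequality `Σ e^{-βKᵢᵢ} ≤ tr e^{-βK} = Z_β(H)`.
[cite: GustafsonSigal2003, §18.3 (18.12)–(18.13), Problem 18.9] [cite: Petz2008, §3.7 Exercise 13] -/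
theorem IsHermitian.vonNeumannEntropy_sub_mul_le_log_partitionFn (hH : H.IsHermitian) (β : ℝ)
    {ρ : Matrix n n ℂ} (hρ : ρ.PosSemidef) (htr : ρ.trace = 1) :
    vonNeumannEntropy ρ - β * (ρ * H).trace.re ≤ Real.log (partitionFn β H).re := by
  haveI : Nonempty n := nonempty_of_trace_eq_one htr
  set V : Matrix n n ℂ := (hρ.1.eigenvectorUnitary : Matrix n n ℂ) with hV
  have hVu : V ∈ unitary (Matrix n n ℂ) := hρ.1.eigenvectorUnitary.prop
  set p : n → ℝ := hρ.1.eigenvalues with hp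
  have hp0 : ∀ i, 0 ≤ p i := fun i => hρ.eigenvalues_nonneg i
  have hp1 : ∑ i, p i = 1 := sum_eigenvalues_eq_one hρ.1 htr
  -- the Hamiltonian in the eigenbasis of `ρ`
  set K : Matrix n n ℂ := star V * H * V with hK
  have hKh : K.IsHermitian := by
    have h := isHermitian_conjTranspose_mul_mul V hH
    rwa [← star_eq_conjTranspose] at h
  -- energy: `Re tr(ρH) = Σ pᵢ Re Kᵢᵢ`
  have hE : (ρ * H).trace.re = ∑ i, p i * (K i i).re := by
    have h1 : (ρ * H).trace = (diagonal (fun i => (p i : ℂ)) * K).trace := by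
      conv_lhs => rw [hρ.1.eq_conj_diagonal]
      rw [trace_unitary_conj_mul]
    rw [h1, trace, Complex.re_sum]
    refine sum_congr rfl fun i _ => ?_
    rw [diag_apply, diagonal_mul, Complex.re_ofReal_mul]
  -- entropy: `S(ρ) = Σ η(pᵢ)`
  have hS : vonNeumannEntropy ρ = ∑ i, Real.negMulLog (p i) := vonNeumannEntropy_eq hρ.1
  -- Gibbs' inequality with `bᵢ = -β Re Kᵢᵢ`
  have hcl := sum_negMulLog_add_mul_le_log_sum_exp hp0 hp1 (fun i => -(β * (K i i).re))
  -- Peierls' inequality for `M = -βK`, and `tr e^{-βK} = Z_β(K) = Z_β(H)`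
  have hM : (-(β : ℂ) • K).IsHermitian := isHermitian_neg_smul β hKh
  have hPe := hM.sum_exp_apply_le_trace_exp
  have hdiag : ∀ i, ((-(β : ℂ) • K) i i).re = -(β * (K i i).re) := by
    intro i
    simp [Matrix.smul_apply]
  simp only [hdiag] at hPe
  have hZK : (NormedSpace.exp (-(β : ℂ) • K)).trace = partitionFn β H := by
    rw [← partitionFn_unitary_conj (Unitary.star_mem hVu) β H, star_star]
    rfl
  rw [hZK] at hPe
  have hWpos : 0 < ∑ i, Real.exp (-(β * (K i i).re)) :=
    sum_pos (fun i _ => Real.exp_pos _) univ_nonempty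
  have hlog := Real.log_le_log hWpos hPe
  have hsum : ∑ i, p i * -(β * (K i i).re) = -(β * ∑ i, p i * (K i i).re) := by
    rw [mul_sum, ← sum_neg_distrib]
    exact sum_congr rfl fun i _ => by ring
  rw [hS, hE]
  linarith [hcl, hlog, hsum]

/-- **The Gibbs variational principle, free-energy form** (`β > 0`): for every density matrix `ρ`,
`−β⁻¹ log Z_β(H) ≤ Re tr(ρH) − β⁻¹ S(ρ)` — the Helmholtz free energy `−T log Z` is below the free
energy `E(ρ) − T S(ρ)` of every state. [cite: GustafsonSigal2003, §18.3 (18.13), Problem 18.9]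
[cite: Petz2008, §3.7 Exercise 13] -/
theorem IsHermitian.helmholtz_le_energy_sub_entropy_div (hH : H.IsHermitian) {β : ℝ} (hβ : 0 < β)
    {ρ : Matrix n n ℂ} (hρ : ρ.PosSemidef) (htr : ρ.trace = 1) :
    -(Real.log (partitionFn β H).re) / β ≤ (ρ * H).trace.re - vonNeumannEntropy ρ / β := by
  have h := hH.vonNeumannEntropy_sub_mul_le_log_partitionFn β hρ htr
  rw [div_le_iff₀ hβ, sub_mul, div_mul_cancel₀ _ hβ.ne']
  linarith

/-- **Trial states without entropy**: for every density matrix `ρ` and every real `β`,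
`−log Z_β(H) ≤ β Re tr(ρH)` (drop `S(ρ) ≥ 0`). In particular (`β > 0`) every variational
(zero-temperature) energy upper bound is an upper bound on the free energy `−β⁻¹ log Z_β` at every
temperature.
[cite: GustafsonSigal2003, §18.3 (18.13)] -/
theorem IsHermitian.neg_log_partitionFn_le_mul_trace (hH : H.IsHermitian) (β : ℝ)
    {ρ : Matrix n n ℂ} (hρ : ρ.PosSemidef) (htr : ρ.trace = 1) :
    -Real.log (partitionFn β H).re ≤ β * (ρ * H).trace.re := by
  have h := hH.vonNeumannEntropy_sub_mul_le_log_partitionFn β hρ htr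
  have hS := vonNeumannEntropy_nonneg hρ htr
  linarith

end VariationalPrinciple

/-! ### The Gibbs state attains the bound -/

section GibbsDensity

variable {H : Matrix n n ℂ}

/-- The Gibbs density matrix `ρ_β = Z_β⁻¹ e^{-βH}` represents the Gibbs state:
`tr(ρ_β A) = ⟨A⟩_β`. [cite: GustafsonSigal2003, §18.3 (18.12)] -/
theorem trace_gibbsDensity_mul (β : ℝ) (H A : Matrix n n ℂ) :
    (((partitionFn β H)⁻¹ • gibbsWeight β H) * A).trace = gibbsState β H A := by
  rw [smul_mul, trace_smul, gibbsState_apply, smul_eq_mul]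

/-- `tr ρ_β = 1` whenever `Z_β ≠ 0` (always, for Hermitian `H` on a nonempty type): the Gibbs density
is normalised. [cite: GustafsonSigal2003, §18.3 (18.12)] -/
theorem trace_gibbsDensity (β : ℝ) (H : Matrix n n ℂ) (hZ : partitionFn β H ≠ 0) :
    ((partitionFn β H)⁻¹ • gibbsWeight β H).trace = 1 := by
  rw [trace_smul, smul_eq_mul, ← partitionFn, inv_mul_cancel₀ hZ]

/-- `ρ_β = Z_β⁻¹ e^{-βH} ≥ 0` for Hermitian `H` ("one-parameter family of positive operators").
[cite: GustafsonSigal2003, §18.3 (18.12)] -/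
theorem IsHermitian.posSemidef_gibbsDensity (hH : H.IsHermitian) (β : ℝ) :
    ((partitionFn β H)⁻¹ • gibbsWeight β H).PosSemidef := by
  refine (posDef_gibbsWeight β hH).posSemidef.smul ?_
  rw [hH.partitionFn_eq_ofReal, ← Complex.ofReal_inv]
  exact Complex.zero_le_real.mpr (inv_nonneg.mpr (sum_nonneg fun i _ => (Real.exp_pos _).le))

/-- The Gibbs density through the functional calculus (spectral mapping): `ρ_β = g(H)` with
`g(x) = e^{-βx} / Σⱼ e^{-βEⱼ}`, i.e. `ρ_β = Σᵢ qᵢ P_{ψᵢ}` with the Boltzmann weights `qᵢ`.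
[cite: GustafsonSigal2003, §18.3 Theorem 18.10 (proof)] -/
theorem IsHermitian.gibbsDensity_eq_cfc (hH : H.IsHermitian) (β : ℝ) :
    (partitionFn β H)⁻¹ • gibbsWeight β H =
      cfc (fun x : ℝ => (∑ j, Real.exp (-(β * hH.eigenvalues j)))⁻¹ * Real.exp (-(β * x))) H := by
  have hsmul : (-(β : ℂ) • H : Matrix n n ℂ) = (-β : ℝ) • H := by
    ext i j
    simp [Matrix.smul_apply, Complex.real_smul]
  have h1 : gibbsWeight β H = cfc (fun x : ℝ => Real.exp (-(β * x))) H := by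
    have hfun : (fun x : ℝ => Real.exp (-(β * x))) = fun x => Real.exp ((-β) • x) := by
      funext x
      simp only [smul_eq_mul, neg_mul]
    rw [hfun, gibbsWeight, hsmul, cfc_comp_smul (-β) Real.exp H, CFC.real_exp_eq_normedSpace_exp]
  rw [cfc_const_mul (∑ j, Real.exp (-(β * hH.eigenvalues j)))⁻¹ (fun x : ℝ => Real.exp (-(β * x))) H,
    ← h1, hH.partitionFn_eq_ofReal, ← Complex.ofReal_inv]
  ext i j
  simp [Matrix.smul_apply, Complex.real_smul]

/-- **The von Neumann entropy of the Gibbs state is the Gibbs entropy**: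
`S(Z_β⁻¹ e^{-βH}) = Matrix.gibbsEntropy β H = log Z_β + β Re⟨H⟩_β` (both equal `−Σ qᵢ log qᵢ` for the
Boltzmann weights `qᵢ = e^{-βEᵢ}/Σⱼ e^{-βEⱼ}`). [cite: NielsenChuang2010, §11.3 eq. (11.40)]
[cite: GustafsonSigal2003, §18.3 Problem 18.9] -/
theorem IsHermitian.vonNeumannEntropy_gibbsDensity [Nonempty n] (hH : H.IsHermitian) (β : ℝ) :
    vonNeumannEntropy ((partitionFn β H)⁻¹ • gibbsWeight β H) = gibbsEntropy β H := by
  set Zr : ℝ := ∑ j, Real.exp (-(β * hH.eigenvalues j)) with hZr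
  set g : ℝ → ℝ := fun x => Zr⁻¹ * Real.exp (-(β * x)) with hg
  have hρ : (partitionFn β H)⁻¹ • gibbsWeight β H = cfc g H := hH.gibbsDensity_eq_cfc β
  have hρh : ((partitionFn β H)⁻¹ • gibbsWeight β H).IsHermitian :=
    (hH.posSemidef_gibbsDensity β).1
  rw [vonNeumannEntropy_eq_re_trace_cfc_negMulLog hρh, hρ,
    ← cfc_comp' Real.negMulLog g H (hg := Real.continuous_negMulLog.continuousOn)
      (hf := by rw [hg]; fun_prop) (ha := hH.isSelfAdjoint),
    hH.cfc_eq_conj_diagonal, trace_mul_cycle, Unitary.coe_star_mul_self, Matrix.one_mul,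
    trace_diagonal, Complex.re_sum, hH.gibbsEntropy_eq_neg_sum_mul_log β, ← hZr, ← sum_neg_distrib]
  refine sum_congr rfl fun i _ => ?_
  simp only [Complex.ofReal_re, hg, Real.negMulLog]
  ring

/-- **`log Z_β(H) = max_ρ [S(ρ) − β Re tr(ρH)]`** over density matrices, attained at the Gibbs state
(the variational CHARACTERISATION of the free energy). [cite: GustafsonSigal2003, §18.3 (18.13), Problem 18.9]
[cite: Petz2008, §3.7 Exercise 13] -/
theorem IsHermitian.log_partitionFn_eq_gibbs_sup [Nonempty n] (hH : H.IsHermitian) (β : ℝ) :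
    IsGreatest {x : ℝ | ∃ ρ : Matrix n n ℂ, ρ.PosSemidef ∧ ρ.trace = 1 ∧
        x = vonNeumannEntropy ρ - β * (ρ * H).trace.re}
      (Real.log (partitionFn β H).re) := by
  constructor
  · refine ⟨(partitionFn β H)⁻¹ • gibbsWeight β H, hH.posSemidef_gibbsDensity β,
      trace_gibbsDensity β H (partitionFn_pos β hH).ne', ?_⟩
    rw [hH.vonNeumannEntropy_gibbsDensity, trace_gibbsDensity_mul, gibbsEntropy_def]
    ring
  · rintro x ⟨ρ, hρ, htr, rfl⟩
    exact hH.vonNeumannEntropy_sub_mul_le_log_partitionFn β hρ htr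

end GibbsDensity

/-! ### Free energy, energy and ground energy -/

section EnergyBounds

variable [Nonempty n] {H : Matrix n n ℂ}

/-- **`F ≤ E₀`**: `−log Z_β(H) ≤ β E₀(H)` (keep the ground-state term of `Z_β = Σ e^{-βEᵢ}`; every
real `β`). [cite: GustafsonSigal2003, §18.3 Theorem 18.10 (proof)] -/
theorem IsHermitian.neg_log_partitionFn_le_mul_groundEnergy (hH : H.IsHermitian) (β : ℝ) :
    -Real.log (partitionFn β H).re ≤ β * H.groundEnergy := by
  have h1 : Real.exp (-(β * H.groundEnergy)) ≤ (partitionFn β H).re := by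
    rw [hH.partitionFn_eq_ofReal, Complex.ofReal_re, groundEnergy_eq_iInf_eigenvalues_holds hH]
    obtain ⟨i₀, hi₀⟩ := exists_eq_ciInf_of_finite (f := hH.eigenvalues)
    rw [← hi₀]
    exact single_le_sum (f := fun i => Real.exp (-(β * hH.eigenvalues i)))
      (fun i _ => (Real.exp_pos _).le) (mem_univ i₀)
  have h2 := Real.log_le_log (Real.exp_pos _) h1
  rw [Real.log_exp] at h2
  linarith

/-- **`E₀ ≤ E_β`**: the Gibbs state does not go below the ground energy, `E₀(H) ≤ Re⟨H⟩_β`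
(`H − E₀ ≥ 0` and positivity of the Gibbs state; every real `β`). The same statement for a general
observable is the Summits-side helper `…HubbardLadder.Bounds.groundEnergy_le_re_gibbsState`.
[cite: GustafsonSigal2003, §18.3 (18.12)] -/
theorem IsHermitian.groundEnergy_le_re_gibbsState_self (hH : H.IsHermitian) (β : ℝ) :
    H.groundEnergy ≤ (gibbsState β H H).re := by
  have hpsd : (H - ((H.groundEnergy : ℝ) : ℂ) • (1 : Matrix n n ℂ)).PosSemidef := by
    have h := posSemidef_sub_groundEnergy hH
    rwa [Algebra.algebraMap_eq_smul_one, RCLike.real_smul_eq_coe_smul (K := ℂ)] at h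
  have h0 := gibbsState_nonneg_of_posSemidef β hH hpsd
  rw [map_sub, map_smul, gibbsState_one β H (partitionFn_pos β hH).ne', smul_eq_mul, mul_one] at h0
  obtain ⟨hre, -⟩ := Complex.nonneg_iff.mp h0
  rw [Complex.sub_re, Complex.ofReal_re] at hre
  linarith

/-- **`F ≤ E`** (`β > 0`): `−log Z_β(H) ≤ β Re⟨H⟩_β`, i.e. the free energy is below the mean energy
(the entropy of the Gibbs state is non-negative, `IsHermitian.gibbsEntropy_nonneg`). [cite: Ruelle1969, §2.5–2.6] -/
theorem IsHermitian.neg_log_partitionFn_le_mul_energy (hH : H.IsHermitian) (β : ℝ) :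
    -Real.log (partitionFn β H).re ≤ β * (gibbsState β H H).re := by
  have h := hH.gibbsEntropy_nonneg β
  rw [gibbsEntropy_def] at h
  linarith

/-- **`E ≤ F + T S_max`**: `β Re⟨H⟩_β ≤ log dim − log Z_β(H)` (the entropy of the Gibbs state is at
most `log dim`, `IsHermitian.gibbsEntropy_le_log_card`; every real `β`). This is the convexity chord of
`log Z` from infinite temperature (`log Z_0 = log dim`). [cite: Ruelle1969, §2.5–2.6] -/
theorem IsHermitian.mul_energy_le_log_card_sub_log_partitionFn (hH : H.IsHermitian) (β : ℝ) :
    β * (gibbsState β H H).re ≤ Real.log (Fintype.card n) - Real.log (partitionFn β H).re := by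
  have h := hH.gibbsEntropy_le_log_card β
  rw [gibbsEntropy_def] at h
  linarith

end EnergyBounds

/-! ### Free-energy windows ⇒ energy windows (convexity chords in `β`) -/

section Windows

variable [Nonempty n] {H : Matrix n n ℂ}

/-- **Cold chord ≤ energy**: for `0 < β < β_c`,
`(log Z_β − log Z_{β_c})/(β_c − β) ≤ Re⟨H⟩_β` — the supporting line of the convex `β ↦ log Z_β` at
`β`, read at the colder `β_c` (`log_partitionFn_sub_mul_energy_le`). [cite: Ruelle1969, §2.5–2.6] -/
theorem IsHermitian.chord_le_energy (hH : H.IsHermitian) {β βc : ℝ} (hβ : 0 < β) (hlt : β < βc) :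
    (Real.log (partitionFn β H).re - Real.log (partitionFn βc H).re) / (βc - β) ≤
      (gibbsState β H H).re := by
  have h := log_partitionFn_sub_mul_energy_le hH βc hβ
  rw [div_le_iff₀ (sub_pos.mpr hlt)]
  linarith

/-- **Energy ≤ hot chord**: for `0 < β_h < β`,
`Re⟨H⟩_β ≤ (log Z_{β_h} − log Z_β)/(β − β_h)` — the supporting line at `β`, read at the hotter `β_h`.
[cite: Ruelle1969, §2.5–2.6] -/
theorem IsHermitian.energy_le_chord (hH : H.IsHermitian) {β βh : ℝ} (hβ : 0 < β) (hlt : βh < β) :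
    (gibbsState β H H).re ≤
      (Real.log (partitionFn βh H).re - Real.log (partitionFn β H).re) / (β - βh) := by
  have h := log_partitionFn_sub_mul_energy_le hH βh hβ
  rw [le_div_iff₀ (sub_pos.mpr hlt)]
  linarith

/-- **Energy window from free-energy bounds at three temperatures** (`0 < β_h < β < β_c`): a LOWER
bound `ℓ ≤ log Z_β` (an upper bound on the free energy at the target temperature, e.g. from the Gibbs
variational principle with a trial state) together with UPPER bounds `log Z_{β_h} ≤ u_h`,
`log Z_{β_c} ≤ u_c` (lower bounds on the free energy at a hotter and at a colder temperature) confine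
the mean energy: `(ℓ − u_c)/(β_c − β) ≤ Re⟨H⟩_β ≤ (u_h − ℓ)/(β − β_h)`. [cite: Ruelle1969, §2.5–2.6] -/
theorem IsHermitian.energy_window_of_log_partitionFn_bounds (hH : H.IsHermitian) {β βh βc : ℝ}
    (hβh : 0 < βh) (hh : βh < β) (hc : β < βc) {ℓ uh uc : ℝ}
    (hℓ : ℓ ≤ Real.log (partitionFn β H).re) (huh : Real.log (partitionFn βh H).re ≤ uh)
    (huc : Real.log (partitionFn βc H).re ≤ uc) :
    (ℓ - uc) / (βc - β) ≤ (gibbsState β H H).re ∧ (gibbsState β H H).re ≤ (uh - ℓ) / (β - βh) := by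
  have hβ : 0 < β := hβh.trans hh
  constructor
  · refine le_trans ?_ (hH.chord_le_energy hβ hc)
    exact div_le_div_of_nonneg_right (by linarith) (sub_pos.mpr hc).le
  · refine le_trans (hH.energy_le_chord hβ hh) ?_
    exact div_le_div_of_nonneg_right (by linarith) (sub_pos.mpr hh).le

/-- **Energy window from a ground-energy bound and one free-energy bound** (`β > 0`): `ℓ₀ ≤ E₀(H)`
and `ℓ ≤ log Z_β(H)` give `ℓ₀ ≤ Re⟨H⟩_β ≤ (log dim − ℓ)/β` (`E₀ ≤ E_β` and the infinite-temperature
chord `β E_β ≤ log dim − log Z_β`). This is the zero-cost window: its width is at least `log dim / β`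
per unit of `log dim`, i.e. `T·s_max` per site for a lattice system. [cite: Ruelle1969, §2.5–2.6] -/
theorem IsHermitian.energy_window_of_groundEnergy_bound (hH : H.IsHermitian) {β : ℝ} (hβ : 0 < β)
    {ℓ₀ ℓ : ℝ} (hℓ₀ : ℓ₀ ≤ H.groundEnergy) (hℓ : ℓ ≤ Real.log (partitionFn β H).re) :
    ℓ₀ ≤ (gibbsState β H H).re ∧
      (gibbsState β H H).re ≤ (Real.log (Fintype.card n) - ℓ) / β := by
  constructor
  · exact hℓ₀.trans (hH.groundEnergy_le_re_gibbsState_self β)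
  · rw [le_div_iff₀ hβ, mul_comm]
    have h := hH.mul_energy_le_log_card_sub_log_partitionFn β
    linarith

/-- **An energy upper bound propagates to all colder temperatures**: if `Re⟨H⟩_β ≤ u` and `β ≤ β'`
(`β > 0`), then `Re⟨H⟩_{β'} ≤ u` (the mean energy is antitone in `β`). [cite: Ruelle1969, §2.5–2.6] -/
theorem IsHermitian.energy_le_of_le_of_le (hH : H.IsHermitian) {β β' u : ℝ} (hβ : 0 < β)
    (hle : β ≤ β') (hu : (gibbsState β H H).re ≤ u) : (gibbsState β' H H).re ≤ u :=
  (hH.re_gibbsState_self_antitone hβ hle).trans hu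

/-- **An energy lower bound propagates to all hotter temperatures**: if `ℓ ≤ Re⟨H⟩_β` and
`0 < β' ≤ β`, then `ℓ ≤ Re⟨H⟩_{β'}`. [cite: Ruelle1969, §2.5–2.6] -/
theorem IsHermitian.le_energy_of_le_of_le (hH : H.IsHermitian) {β β' ℓ : ℝ} (hβ' : 0 < β')
    (hle : β' ≤ β) (hℓ : ℓ ≤ (gibbsState β H H).re) : ℓ ≤ (gibbsState β' H H).re :=
  hℓ.trans (hH.re_gibbsState_self_antitone hβ' hle)

/-- **Energy window on a temperature INTERVAL** (`0 < β₁ ≤ β₂`): a lower bound certified at the cold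
end `β₂` and an upper bound certified at the hot end `β₁` hold throughout `[β₁, β₂]`:
`ℓ ≤ Re⟨H⟩_{β₂}` and `Re⟨H⟩_{β₁} ≤ u` give `ℓ ≤ Re⟨H⟩_β ≤ u` for every `β ∈ [β₁, β₂]`.
[cite: Ruelle1969, §2.5–2.6] -/
theorem IsHermitian.energy_window_on_interval (hH : H.IsHermitian) {β₁ β₂ ℓ u : ℝ} (hβ₁ : 0 < β₁)
    (hℓ : ℓ ≤ (gibbsState β₂ H H).re) (hu : (gibbsState β₁ H H).re ≤ u) {β : ℝ} (h₁ : β₁ ≤ β)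
    (h₂ : β ≤ β₂) : ℓ ≤ (gibbsState β H H).re ∧ (gibbsState β H H).re ≤ u :=
  ⟨hH.le_energy_of_le_of_le (hβ₁.trans_le h₁) h₂ hℓ, hH.energy_le_of_le_of_le hβ₁ h₁ hu⟩

end Windows

end Matrix
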